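import Literature.Probability.RandomPlanarGeometry.ParaObservableFarField
import Literature.Probability.RandomPlanarGeometry.SpinObservableLocalMartingale
import HarnessLib

/-!
# The time-limited spin-1/3 observable process: adaptedness, the cylinder identity, and the
# far-field expansion at the doubly stopped clock

Topic `Literature/Probability/RandomPlanarGeometry` (deterministic Loewner calculus + a thin
probabilistic layer; theorems only, no definition, no named fact). Percolation (`κ = 6`)
companion of `ObservableAdapted.lean`, `SpinObservableShortTime.lean` and the expansion section
of `ObservableLocalMartingale.lean`, for the time-limited spin-1/3 observable process
`N^y_t(ω) = (iy g_t'(iy)/(g_t(iy) - W_t))^{1/3}` of the path `W · ω` of a real process `W`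
(time first), frozen at CDHKS's time horizon `T(iy) = y²/9` — written throughout with the
explicit expression (literally the body of the percolation routes' `paraObservableProcess W y t ω`,
no new definition):

* `continuous_paraObservableProcess`, `norm_paraObservableProcess_le` — continuous paths,
  bounded by `2`;
* `measurable_paraObservable`, `measurable_paraObservableProcess`,
  `stronglyAdapted_re_im_paraObservableProcess` — a measurable functional of the driving path
  up to the present, hence adapted to every filtration to which `W` is adapted;
* `martingale_re_im_paraObservableProcess_of_cylinder` — the complex cylinder identity
  `E[(N^y_t - N^y_s) ψ(W_S)] = 0` makes `Re N^y`, `Im N^y` martingales in the natural filtration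
  of `W` (monotone class, `Process.martingale_natural_of_integral_cylinder`);
* `norm_stoppedProcess_paraObservableProcess_sub_le`, `para_main_term_eq`,
  `abs_im_stoppedProcess_paraObservableProcess_add_le`,
  `abs_re_stoppedProcess_paraObservableProcess_sub_le` — the far-field expansion
  (`FarRegime.norm_paraObservable_sub_le`) at the clock `r ∧ ρ_L` for every level `y ≥ L`:
  `|Im N + A/(3y)|`, `|Re N - 1 + (2A² - 12σ)/(9y²)| ≤ 64 ((L/128 + √t)/y)³` with
  `A = W_{r∧ρ_L}`, `σ = r ∧ ρ_L` (Duminil-Copin 2012, p. 9: spin `1/3`, `κ = 6`).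

## References

* H. Duminil-Copin, *Divergence of the correlation length for critical planar FK percolation
  with `1 ≤ q ≤ 4` via parafermionic observables*, J. Phys. A 45 (2012) 494013
  (arXiv:1208.3787), p. 9.
* D. Chelkak, H. Duminil-Copin, C. Hongler, A. Kemppainen, S. Smirnov, *Convergence of Ising
  interfaces to Schramm's SLE curves*, C. R. Math. Acad. Sci. Paris 352 (2014), §3.
-/

noncomputable section

open Set Filter Topology Metric MeasureTheory Complex
open scoped NNReal

namespace Literature.Probability.RandomPlanarGeometry

namespace Loewner

open Literature.Probability.Process

variable {Ω : Type*} {m : MeasurableSpace Ω} {W : ℝ≥0 → Ω → ℝ}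

/-- **The time-limited spin-1/3 observable process has continuous paths** (every `ω`; `W` with
continuous paths, `y > 0`). [folklore] -/
theorem continuous_paraObservableProcess (hWc : ∀ ω, Continuous (W · ω)) {y : ℝ} (hy : 0 < y)
    (ω : Ω) : Continuous fun t ↦ (((I * y) * deriv (map (fun u ↦ W u ω) (min t (cdhksTime y))) (I * y) /
          (map (fun u ↦ W u ω) (min t (cdhksTime y)) (I * y) - ((W (min t (cdhksTime y)) ω : ℝ) : ℂ))) ^ ((3 : ℂ)⁻¹)) :=
  continuous_paraObservable_min (hWc ω) hy

/-- The time-limited spin-1/3 observable process is bounded by `2`. [folklore] -/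
theorem norm_paraObservableProcess_le (hWc : ∀ ω, Continuous (W · ω)) {y : ℝ} (hy : 0 < y)
    (t : ℝ≥0) (ω : Ω) : ‖(((I * y) * deriv (map (fun u ↦ W u ω) (min t (cdhksTime y))) (I * y) /
          (map (fun u ↦ W u ω) (min t (cdhksTime y)) (I * y) - ((W (min t (cdhksTime y)) ω : ℝ) : ℂ))) ^ ((3 : ℂ)⁻¹))‖ ≤ 2 :=
  norm_paraObservable_min_le (hWc ω) hy t

/-! ### Measurability and adaptedness -/

/-- **The spin-1/3 observable of the path up to time `t` is a measurable functional of the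
driving path up to time `t`** (`9t ≤ y²`, `y > 0`): `g_t(iy)` by `measurable_map_of_im_pos`,
`g_t'(iy)` by `measurable_deriv_map`, and measurability of the principal power. [folklore] -/
theorem measurable_paraObservable (hWc : ∀ ω, Continuous (W · ω)) {t : ℝ≥0}
    (hmeas : ∀ s, s ≤ t → Measurable fun ω ↦ W s ω) {y : ℝ} (hy : 0 < y)
    (h9 : 9 * (t : ℝ) ≤ y ^ 2) :
    Measurable fun ω ↦ (((I * y) * deriv (map (fun u ↦ W u ω) t) (I * y) /
          (map (fun u ↦ W u ω) t (I * y) - ((W t ω : ℝ) : ℂ))) ^ ((3 : ℂ)⁻¹)) := by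
  have hz : 0 < (I * (y : ℂ)).im := by simpa using hy
  have h9' : 9 * (t : ℝ) ≤ (I * (y : ℂ)).im ^ 2 := by simpa using h9
  have hmz : Measurable fun ω ↦ map (fun u ↦ W u ω) t (I * y) :=
    measurable_map_of_im_pos (W := fun ω u ↦ W u ω) hWc hmeas hz
  have hd := measurable_deriv_map hWc hmeas hz h9'
  have hW : Measurable fun ω ↦ ((W t ω : ℝ) : ℂ) := measurable_ofReal.comp (hmeas t le_rfl)
  exact ((hd.const_mul _).div (hmz.sub hW)).pow_const _

/-- **The time-limited spin-1/3 observable process is a measurable functional of the driving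
path up to the present**: `ω ↦ N^y_t(ω)` is measurable for any σ-algebra making `W_s`, `s ≤ t`,
measurable. [folklore] -/
theorem measurable_paraObservableProcess (hWc : ∀ ω, Continuous (W · ω)) {t : ℝ≥0}
    (hmeas : ∀ s, s ≤ t → Measurable fun ω ↦ W s ω) {y : ℝ} (hy : 0 < y) :
    Measurable fun ω ↦ (((I * y) * deriv (map (fun u ↦ W u ω) (min t (cdhksTime y))) (I * y) /
          (map (fun u ↦ W u ω) (min t (cdhksTime y)) (I * y) - ((W (min t (cdhksTime y)) ω : ℝ) : ℂ))) ^ ((3 : ℂ)⁻¹)) := by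
  have h9 : 9 * ((min t (cdhksTime y) : ℝ≥0) : ℝ) ≤ y ^ 2 := by
    have h1 : ((min t (cdhksTime y) : ℝ≥0) : ℝ) ≤ (cdhksTime y : ℝ) :=
      NNReal.coe_le_coe.2 (min_le_right _ _)
    rw [coe_cdhksTime] at h1
    linarith
  exact measurable_paraObservable (t := min t (cdhksTime y)) hWc
    (fun s hs ↦ hmeas s (hs.trans (min_le_left _ _))) hy h9

/-- **Adaptedness**: the real and imaginary parts of the time-limited spin-1/3 observable
process are adapted to every filtration to which `W` (continuous paths) is adapted. [folklore] -/
theorem stronglyAdapted_re_im_paraObservableProcess {𝓕 : Filtration ℝ≥0 m}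
    (hWad : StronglyAdapted 𝓕 W) (hWc : ∀ ω, Continuous (W · ω)) {y : ℝ} (hy : 0 < y) :
    StronglyAdapted 𝓕 (fun t ω ↦ ((((I * y) * deriv (map (fun u ↦ W u ω) (min t (cdhksTime y))) (I * y) /
          (map (fun u ↦ W u ω) (min t (cdhksTime y)) (I * y) - ((W (min t (cdhksTime y)) ω : ℝ) : ℂ))) ^ ((3 : ℂ)⁻¹))).re) ∧
      StronglyAdapted 𝓕 (fun t ω ↦ ((((I * y) * deriv (map (fun u ↦ W u ω) (min t (cdhksTime y))) (I * y) /
            (map (fun u ↦ W u ω) (min t (cdhksTime y)) (I * y) - ((W (min t (cdhksTime y)) ω : ℝ) : ℂ))) ^ ((3 : ℂ)⁻¹))).im) := by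
  have h := fun t ↦ measurable_paraObservableProcess (m := 𝓕 t) (t := t) hWc
    (fun s hs ↦ ((hWad s).mono (𝓕.mono hs)).measurable) hy
  exact ⟨fun t ↦ (measurable_re.comp (h t)).stronglyMeasurable,
    fun t ↦ (measurable_im.comp (h t)).stronglyMeasurable⟩

/-! ### The cylinder identity gives natural-filtration martingales -/

section Bridge

variable {P : Measure Ω} [IsFiniteMeasure P]

/-- The time-limited spin-1/3 observable is integrable on a finite measure space (bounded by `2`
and measurable). [folklore] -/
theorem integrable_paraObservableProcess (hW : ∀ t, StronglyMeasurable (W t))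
    (hWc : ∀ ω, Continuous (W · ω)) {y : ℝ} (hy : 0 < y) (t : ℝ≥0) :
    Integrable (fun ω ↦ (((I * y) * deriv (map (fun u ↦ W u ω) (min t (cdhksTime y))) (I * y) /
          (map (fun u ↦ W u ω) (min t (cdhksTime y)) (I * y) - ((W (min t (cdhksTime y)) ω : ℝ) : ℂ))) ^ ((3 : ℂ)⁻¹))) P := by
  have hmeas : Measurable fun ω ↦ (((I * y) * deriv (map (fun u ↦ W u ω) (min t (cdhksTime y))) (I * y) /
        (map (fun u ↦ W u ω) (min t (cdhksTime y)) (I * y) - ((W (min t (cdhksTime y)) ω : ℝ) : ℂ))) ^ ((3 : ℂ)⁻¹)) :=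
    measurable_paraObservableProcess hWc (fun s _ ↦ (hW s).measurable) hy
  exact (integrable_const (2 : ℝ)).mono' hmeas.aestronglyMeasurable
    (ae_of_all _ fun ω ↦ norm_paraObservableProcess_le hWc hy t ω)

/-- The cylinder integrand `(N_t - N_s) ψ(W_S)` is integrable (bounded by `4`, measurable).
[folklore] -/
theorem integrable_paraCylinderIntegrand (hW : ∀ t, StronglyMeasurable (W t))
    (hWc : ∀ ω, Continuous (W · ω)) {y : ℝ} (hy : 0 < y) (s t : ℝ≥0) {n : ℕ} (S : Fin n → ℝ≥0)
    {ψ : (Fin n → ℝ) → ℝ} (hψc : Continuous ψ) (hψ1 : ∀ v, |ψ v| ≤ 1) :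
    Integrable (fun ω ↦ ((((I * y) * deriv (map (fun u ↦ W u ω) (min t (cdhksTime y))) (I * y) /
          (map (fun u ↦ W u ω) (min t (cdhksTime y)) (I * y) - ((W (min t (cdhksTime y)) ω : ℝ) : ℂ))) ^ ((3 : ℂ)⁻¹)) - (((I * y) * deriv (map (fun u ↦ W u ω) (min s (cdhksTime y))) (I * y) /
                (map (fun u ↦ W u ω) (min s (cdhksTime y)) (I * y) - ((W (min s (cdhksTime y)) ω : ℝ) : ℂ))) ^ ((3 : ℂ)⁻¹))) * (ψ (fun k ↦ W (S k) ω) : ℂ)) P := by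
  have hV : Measurable fun ω ↦ (fun k ↦ W (S k) ω : Fin n → ℝ) :=
    measurable_pi_lambda _ fun k ↦ (hW (S k)).measurable
  have hψm : Measurable fun ω ↦ (ψ (fun k ↦ W (S k) ω) : ℂ) :=
    measurable_ofReal.comp (hψc.measurable.comp hV)
  have hN := fun r ↦ measurable_paraObservableProcess (t := r) hWc (fun u _ ↦ (hW u).measurable) hy
  refine (integrable_const (4 : ℝ)).mono' (((hN t).sub (hN s)).mul hψm).aestronglyMeasurable
    (ae_of_all _ fun ω ↦ ?_)
  rw [norm_mul, Complex.norm_real, Real.norm_eq_abs]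
  have ht := norm_paraObservableProcess_le hWc hy t ω
  have hs := norm_paraObservableProcess_le hWc hy s ω
  have h1 : ‖(((I * y) * deriv (map (fun u ↦ W u ω) (min t (cdhksTime y))) (I * y) /
        (map (fun u ↦ W u ω) (min t (cdhksTime y)) (I * y) - ((W (min t (cdhksTime y)) ω : ℝ) : ℂ))) ^ ((3 : ℂ)⁻¹)) - (((I * y) * deriv (map (fun u ↦ W u ω) (min s (cdhksTime y))) (I * y) /
              (map (fun u ↦ W u ω) (min s (cdhksTime y)) (I * y) - ((W (min s (cdhksTime y)) ω : ℝ) : ℂ))) ^ ((3 : ℂ)⁻¹))‖ ≤ 4 := (norm_sub_le _ _).trans (by linarith)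
  have h2 := hψ1 (fun k ↦ W (S k) ω)
  calc ‖(((I * y) * deriv (map (fun u ↦ W u ω) (min t (cdhksTime y))) (I * y) /
        (map (fun u ↦ W u ω) (min t (cdhksTime y)) (I * y) - ((W (min t (cdhksTime y)) ω : ℝ) : ℂ))) ^ ((3 : ℂ)⁻¹)) - (((I * y) * deriv (map (fun u ↦ W u ω) (min s (cdhksTime y))) (I * y) /
              (map (fun u ↦ W u ω) (min s (cdhksTime y)) (I * y) - ((W (min s (cdhksTime y)) ω : ℝ) : ℂ))) ^ ((3 : ℂ)⁻¹))‖ * |ψ fun k ↦ W (S k) ω| ≤ 4 * 1 :=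
        mul_le_mul h1 h2 (abs_nonneg _) (by norm_num)
    _ = 4 := by norm_num

/-- **Real and imaginary parts of the time-limited spin-1/3 observable are natural-filtration
martingales as soon as the complex cylinder identity holds**: adaptedness and the
monotone-class theorem (`Process.martingale_natural_of_integral_cylinder`), after taking real
and imaginary parts of the complex identity. [folklore] -/
theorem martingale_re_im_paraObservableProcess_of_cylinder (hW : ∀ t, StronglyMeasurable (W t))
    (hWc : ∀ ω, Continuous (W · ω)) {y : ℝ} (hy : 0 < y)
    (h : ∀ s t : ℝ≥0, s ≤ t → ∀ (n : ℕ) (S : Fin n → ℝ≥0), (∀ k, S k ≤ s) →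
      ∀ ψ : (Fin n → ℝ) → ℝ, Continuous ψ → (∀ v, |ψ v| ≤ 1) →
        ∫ ω, ((((I * y) * deriv (map (fun u ↦ W u ω) (min t (cdhksTime y))) (I * y) /
              (map (fun u ↦ W u ω) (min t (cdhksTime y)) (I * y) - ((W (min t (cdhksTime y)) ω : ℝ) : ℂ))) ^ ((3 : ℂ)⁻¹)) - (((I * y) * deriv (map (fun u ↦ W u ω) (min s (cdhksTime y))) (I * y) /
                    (map (fun u ↦ W u ω) (min s (cdhksTime y)) (I * y) - ((W (min s (cdhksTime y)) ω : ℝ) : ℂ))) ^ ((3 : ℂ)⁻¹))) * (ψ (fun k ↦ W (S k) ω) : ℂ) ∂P = 0) :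
    Martingale (fun t ω ↦ ((((I * y) * deriv (map (fun u ↦ W u ω) (min t (cdhksTime y))) (I * y) /
          (map (fun u ↦ W u ω) (min t (cdhksTime y)) (I * y) - ((W (min t (cdhksTime y)) ω : ℝ) : ℂ))) ^ ((3 : ℂ)⁻¹))).re) (Filtration.natural W hW) P ∧
    Martingale (fun t ω ↦ ((((I * y) * deriv (map (fun u ↦ W u ω) (min t (cdhksTime y))) (I * y) /
          (map (fun u ↦ W u ω) (min t (cdhksTime y)) (I * y) - ((W (min t (cdhksTime y)) ω : ℝ) : ℂ))) ^ ((3 : ℂ)⁻¹))).im) (Filtration.natural W hW) P := by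
  obtain ⟨hre, him⟩ := stronglyAdapted_re_im_paraObservableProcess
    (Filtration.stronglyAdapted_natural hW) hWc hy
  have hint := fun t ↦ integrable_paraObservableProcess (P := P) hW hWc hy t
  constructor
  · refine Process.martingale_natural_of_integral_cylinder hW hre (fun t ↦ (hint t).re)
      fun s t hst n S hS ψ hψc hψ1 ↦ ?_
    have hI := integrable_paraCylinderIntegrand (P := P) hW hWc hy s t S hψc hψ1
    have h0 := h s t hst n S hS ψ hψc hψ1
    have h1 := integral_re hI
    simp only [RCLike.re_to_complex, h0, Complex.zero_re] at h1
    rw [← h1]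
    refine integral_congr_ae (ae_of_all _ fun ω ↦ ?_)
    simp only [Complex.re_mul_ofReal, Complex.sub_re]
  · refine Process.martingale_natural_of_integral_cylinder hW him (fun t ↦ (hint t).im)
      fun s t hst n S hS ψ hψc hψ1 ↦ ?_
    have hI := integrable_paraCylinderIntegrand (P := P) hW hWc hy s t S hψc hψ1
    have h0 := h s t hst n S hS ψ hψc hψ1
    have h1 := integral_im hI
    simp only [RCLike.im_to_complex, h0, Complex.zero_im] at h1
    rw [← h1]
    refine integral_congr_ae (ae_of_all _ fun ω ↦ ?_)
    simp only [Complex.im_mul_ofReal, Complex.sub_im]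

end Bridge

/-! ### The far-field expansion at the doubly stopped clock -/

section Expansion

/-- **The time-limited spin-1/3 observable at the clock `r ∧ ρ_L` is the observable there**
(`y ≥ L > 0`: the clock is below the time horizon `y²/9`). [folklore] -/
theorem stoppedProcess_paraObservableProcess_level (hWc : ∀ ω, Continuous (W · ω)) {L y : ℝ}
    (hL : 0 < L) (hLy : L ≤ y) (r : ℝ≥0) (ω : Ω) :
    stoppedProcess (fun t ω ↦ (((I * y) * deriv (map (fun u ↦ W u ω) (min t (cdhksTime y))) (I * y) /
          (map (fun u ↦ W u ω) (min t (cdhksTime y)) (I * y) - ((W (min t (cdhksTime y)) ω : ℝ) : ℂ))) ^ ((3 : ℂ)⁻¹))) (farStopTime W L) r ω =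
      (((I * y) * deriv (map (fun u ↦ W u ω) ((min (r : WithTop ℝ≥0) (farStopTime W L ω)).untopA)) (I * y) /
            (map (fun u ↦ W u ω) ((min (r : WithTop ℝ≥0) (farStopTime W L ω)).untopA) (I * y) - ((W ((min (r : WithTop ℝ≥0) (farStopTime W L ω)).untopA) ω : ℝ) : ℂ))) ^ ((3 : ℂ)⁻¹)) := by
  simp only [stoppedProcess]
  rw [min_eq_left (untopA_min_farStopTime_le_cdhksTime hWc hL hLy r ω)]

/-- **Pathwise expansion of the spin-1/3 observable at the clock `r ∧ ρ_L`, level `y ≥ L`**: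
with `A = W_{r∧ρ_L}`, `σ = r ∧ ρ_L` and `r ≤ t`,
`‖N^y_{r∧ρ_L} - (1 + A/(3iy) + (2A² - 12σ)/(9(iy)²))‖ ≤ 64 ((L/128 + √t)/y)³`.
[cite: DuminilCopin2012Parafermion, p. 9] -/
theorem norm_stoppedProcess_paraObservableProcess_sub_le (hWc : ∀ ω, Continuous (W · ω))
    (hW0 : ∀ ω, W 0 ω = 0) {L y : ℝ} (hL : 0 < L) (hLy : L ≤ y) {r t : ℝ≥0} (hr : r ≤ t)
    (ω : Ω) :
    ‖stoppedProcess (fun t ω ↦ (((I * y) * deriv (map (fun u ↦ W u ω) (min t (cdhksTime y))) (I * y) /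
          (map (fun u ↦ W u ω) (min t (cdhksTime y)) (I * y) - ((W (min t (cdhksTime y)) ω : ℝ) : ℂ))) ^ ((3 : ℂ)⁻¹))) (farStopTime W L) r ω -
        (1 + ((stoppedProcess W (farStopTime W L) r ω : ℝ) : ℂ) / (3 * (I * y)) +
          (2 * ((stoppedProcess W (farStopTime W L) r ω : ℝ) : ℂ) ^ 2 -
              12 * (((min (r : WithTop ℝ≥0) (farStopTime W L ω)).untopA : ℝ) : ℂ)) /
            (9 * (I * y) ^ 2))‖ ≤
      64 * ((L / 128 + Real.sqrt t) / y) ^ 3 := by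
  have hreg := farRegime_stopped_level hWc hW0 hL hLy r ω
  have hy : 0 < y := hL.trans_le hLy
  set σ := (min (r : WithTop ℝ≥0) (farStopTime W L ω)).untopA with hσ
  have hσt : σ ≤ t := (untopA_min_coe_le r _).trans hr
  have hmain := hreg.norm_paraObservable_sub_le
  have hnorm : ‖I * (y : ℂ)‖ = y := by simp [abs_of_pos hy]
  rw [hnorm] at hmain
  rw [stoppedProcess_paraObservableProcess_level hWc hL hLy r ω]
  refine (le_of_eq ?_).trans (hmain.trans ?_)
  · rfl
  · have hK : L / 128 + Real.sqrt σ ≤ L / 128 + Real.sqrt t := by gcongr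
    have hK0 : 0 ≤ L / 128 + Real.sqrt σ := add_nonneg (by positivity) (Real.sqrt_nonneg _)
    gcongr

/-- Real and imaginary parts of the main term at `z = iy` (`w`, `σ` real):
`1 + w/(3iy) + (2w² - 12σ)/(9(iy)²) = (1 - (2w² - 12σ)/(9y²)) + (-w/(3y)) i`. [folklore] -/
theorem para_main_term_eq {y : ℝ} (hy : y ≠ 0) (w s : ℝ) :
    (1 : ℂ) + (w : ℂ) / (3 * (I * y)) + (2 * (w : ℂ) ^ 2 - 12 * (s : ℂ)) / (9 * (I * y) ^ 2) =
      ((1 - (2 * w ^ 2 - 12 * s) / (9 * y ^ 2) : ℝ) : ℂ) + ((-w / (3 * y) : ℝ) : ℂ) * I := by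
  have hy' : (y : ℂ) ≠ 0 := by exact_mod_cast hy
  push_cast
  field_simp
  ring_nf
  simp only [I_sq, I_pow_three]
  ring

/-- **Imaginary part at the doubly stopped clock: `|Im N + A/(3y)| ≤ 64 ((L/128 + √t)/y)³`.**
[folklore] -/
theorem abs_im_stoppedProcess_paraObservableProcess_add_le (hWc : ∀ ω, Continuous (W · ω))
    (hW0 : ∀ ω, W 0 ω = 0) {L y : ℝ} (hL : 0 < L) (hLy : L ≤ y) {r t : ℝ≥0} (hr : r ≤ t)
    (ω : Ω) :
    |(stoppedProcess (fun t ω ↦ (((I * y) * deriv (map (fun u ↦ W u ω) (min t (cdhksTime y))) (I * y) /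
          (map (fun u ↦ W u ω) (min t (cdhksTime y)) (I * y) - ((W (min t (cdhksTime y)) ω : ℝ) : ℂ))) ^ ((3 : ℂ)⁻¹))) (farStopTime W L) r ω).im +
        stoppedProcess W (farStopTime W L) r ω / (3 * y)| ≤
      64 * ((L / 128 + Real.sqrt t) / y) ^ 3 := by
  have hy : 0 < y := hL.trans_le hLy
  have h := norm_stoppedProcess_paraObservableProcess_sub_le hWc hW0 hL hLy hr ω
  rw [para_main_term_eq hy.ne'] at h
  set a : ℝ := 1 - (2 * stoppedProcess W (farStopTime W L) r ω ^ 2 -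
      12 * ((min (r : WithTop ℝ≥0) (farStopTime W L ω)).untopA : ℝ)) / (9 * y ^ 2) with ha
  set b : ℝ := -stoppedProcess W (farStopTime W L) r ω / (3 * y) with hb
  set O := stoppedProcess (fun t ω ↦ (((I * y) * deriv (map (fun u ↦ W u ω) (min t (cdhksTime y))) (I * y) /
        (map (fun u ↦ W u ω) (min t (cdhksTime y)) (I * y) - ((W (min t (cdhksTime y)) ω : ℝ) : ℂ))) ^ ((3 : ℂ)⁻¹))) (farStopTime W L) r ω with hO
  have him : (O - ((a : ℂ) + (b : ℂ) * I)).im =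
      O.im + stoppedProcess W (farStopTime W L) r ω / (3 * y) := by
    simp only [sub_im, add_im, ofReal_im, mul_im, ofReal_re, I_re, I_im, mul_zero, mul_one, zero_add,
      add_zero, hb]
    ring
  rw [← him]
  exact (abs_im_le_norm _).trans h

/-- **Real part at the doubly stopped clock:
`|Re N - 1 + (2A² - 12σ)/(9y²)| ≤ 64 ((L/128 + √t)/y)³`.** [folklore] -/
theorem abs_re_stoppedProcess_paraObservableProcess_sub_le (hWc : ∀ ω, Continuous (W · ω))
    (hW0 : ∀ ω, W 0 ω = 0) {L y : ℝ} (hL : 0 < L) (hLy : L ≤ y) {r t : ℝ≥0} (hr : r ≤ t)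
    (ω : Ω) :
    |(stoppedProcess (fun t ω ↦ (((I * y) * deriv (map (fun u ↦ W u ω) (min t (cdhksTime y))) (I * y) /
          (map (fun u ↦ W u ω) (min t (cdhksTime y)) (I * y) - ((W (min t (cdhksTime y)) ω : ℝ) : ℂ))) ^ ((3 : ℂ)⁻¹))) (farStopTime W L) r ω).re - 1 +
        (2 * stoppedProcess W (farStopTime W L) r ω ^ 2 -
          12 * ((min (r : WithTop ℝ≥0) (farStopTime W L ω)).untopA : ℝ)) / (9 * y ^ 2)| ≤
      64 * ((L / 128 + Real.sqrt t) / y) ^ 3 := by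
  have hy : 0 < y := hL.trans_le hLy
  have h := norm_stoppedProcess_paraObservableProcess_sub_le hWc hW0 hL hLy hr ω
  rw [para_main_term_eq hy.ne'] at h
  set a : ℝ := 1 - (2 * stoppedProcess W (farStopTime W L) r ω ^ 2 -
      12 * ((min (r : WithTop ℝ≥0) (farStopTime W L ω)).untopA : ℝ)) / (9 * y ^ 2) with ha
  set b : ℝ := -stoppedProcess W (farStopTime W L) r ω / (3 * y) with hb
  set O := stoppedProcess (fun t ω ↦ (((I * y) * deriv (map (fun u ↦ W u ω) (min t (cdhksTime y))) (I * y) /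
        (map (fun u ↦ W u ω) (min t (cdhksTime y)) (I * y) - ((W (min t (cdhksTime y)) ω : ℝ) : ℂ))) ^ ((3 : ℂ)⁻¹))) (farStopTime W L) r ω with hO
  have hre : (O - ((a : ℂ) + (b : ℂ) * I)).re = O.re - 1 +
      (2 * stoppedProcess W (farStopTime W L) r ω ^ 2 -
        12 * ((min (r : WithTop ℝ≥0) (farStopTime W L ω)).untopA : ℝ)) / (9 * y ^ 2) := by
    simp only [sub_re, add_re, ofReal_re, mul_re, ofReal_im, I_re, I_im, mul_zero, mul_one, sub_zero,
      ha]
    ring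
  rw [← hre]
  exact (abs_re_le_norm _).trans h

end Expansion

end Loewner

end Literature.Probability.RandomPlanarGeometry
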